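import Literature.RepresentationTheory.FiniteGroups.MackeyFormulaClassFunctions
import Literature.RepresentationTheory.FiniteGroups.VirtualBrauerDescent
import Mathlib.RingTheory.IntegralDomain
import HarnessLib

/-!
# The Brauer pairing count `(B, B) = 1` and its inflation along `Γ ↠ Q` (helper for
# `PotentialCompanionDescent.BrauerTaylorDescent`, item stmt-Langlands-33718)

Barnet-Lamb–Gee–Geraghty–Taylor (*Potential automorphy and change of weight*, Ann. of Math. 179
(2014), proof of Thm. 5.5.1 = arXiv:1010.2561 Thm. 5.4.1, pp. 39–40) write `1 = ∑ᵢ nᵢ Ind θᵢ`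
(Brauer) on `Gal(L/K)` and use, for the virtual representation `B = ∑ᵢ nᵢ [Ind k(ψᵢ)]` of `Γ_K`
(`ψᵢ` the inflation of `θᵢ`), that `(B, B) = 1` and `dim B = 1`.  The abstract descent
`Representation.exists_irreducible_virtualBrauerDescent` takes exactly these two numbers as
hypotheses `hB`, `hdimB`.  This file computes them from the Brauer identity:

* `sum_sum_card_doubleCoset_agree_eq_one` (over `ℂ`, finite group): if `∑ᵢ nᵢ Ind_{Hᵢ} θᵢ = 1` then
  `∑_{i,j} nᵢ nⱼ #{q ∈ Hᵢ\G/Hⱼ : θᵢ^{g_q} = θⱼ on Hⱼ ∩ g_q⁻¹Hᵢg_q} = ⟨1, 1⟩ = 1` (bilinearity,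
  Frobenius reciprocity `classInner_indClassFun_left/right`, Mackey's formula for class functions
  `indClassFun_restrict_eq_sum_doubleCoset`, orthonormality of degree-one characters);
* `finrank_intertwiningMap_coind_ofChar` (over an algebraically closed `k`): Mackey's intertwining
  number formula `finrank_intertwiningMap_coind_coind` + the local term give the same count for
  `dim_k Hom_Q(coind k(θ̃ᵢ), coind k(θ̃ⱼ))`, whence `(B, B) = 1` over `k`
  (`sum_sum_finrank_intertwiningMap_coind_ofChar_eq_one`, characters transported along `e : ℂ →+* k`);
* `sum_mul_index_eq_one` is `dim B = ∑ nᵢ [G : Hᵢ] = 1`; the inflation to `Γ ↠ Q` is in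
  `PotentialCompanionDescentBrauerTaylorDescentDescentData`.

References: BLGGT 2014, proof of Thm. 5.5.1 [BarnetlambEtAl2014]; J.-P. Serre, *Linear
Representations of Finite Groups*, §7.2–§7.4 [SerreLinearRepresentations1977].
-/

-- `Summit.Langlands.Langlands.…` (summit = sub-problem name) trips `dupNamespace`.
set_option linter.dupNamespace false

noncomputable section

open scoped BigOperators
open Literature.RepresentationTheory.FiniteGroups Literature.RepresentationTheory.Semisimple

namespace Summit.Langlands.Langlands.Theorems.BrauerTaylorDescent

variable {G : Type} [Group G]

/-! ## The Brauer pairing count over `ℂ`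

For Brauer data `1 = ∑ᵢ nᵢ Ind_{Hᵢ}^G θᵢ` on a finite group `G`:
`∑_{i,j} nᵢ nⱼ #{q ∈ Hᵢ\G/Hⱼ : θᵢ^{g_q} = θⱼ on Hⱼ ∩ g_q⁻¹ Hᵢ g_q} = ⟨1, 1⟩_G = 1`
(bilinearity of `⟨·,·⟩`, Frobenius reciprocity, Mackey's formula for class functions and the
orthonormality of degree-one characters).  This is the number BLGGT feed into the pairing
`(A, A) = (B, B)` of the proof of Thm. 5.5.1. -/

section PairingOverC

variable [Fintype G]

/-- A degree-one character `θ : D →* ℂˣ` is a class function. [folklore] -/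
theorem isClassFun_coe_hom {D : Type} [Group D] (θ : D →* ℂˣ) :
    IsClassFun (fun d : D => ((θ d : ℂˣ) : ℂ)) := by
  intro s t
  show ((θ (t * s * t⁻¹) : ℂˣ) : ℂ) = θ s
  congr 1
  rw [map_mul, map_mul, map_inv, mul_comm (θ t) (θ s), mul_assoc, mul_inv_cancel, mul_one]

/-- Finite additivity of the scalar product in the first variable. [folklore] -/
theorem classInner_finset_sum_left {D : Type} [Group D] [Fintype D] {κ : Type} (s : Finset κ)
    (f : κ → D → ℂ) (ψ : D → ℂ) :
    classInner (∑ a ∈ s, f a) ψ = ∑ a ∈ s, classInner (f a) ψ := by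
  classical
  induction s using Finset.induction_on with
  | empty => simp [classInner_apply]
  | insert a s ha ih => rw [Finset.sum_insert ha, Finset.sum_insert ha, classInner_add_left, ih]

/-- **Orthonormality of degree-one characters**: `⟨λ, μ⟩_D = [λ = μ]` for `λ μ : D →* ℂˣ`
(`∑_d ν(d) = 0` for a non-trivial `ν = λμ⁻¹`, Mathlib `sum_hom_units_eq_zero`).
[cite: SerreLinearRepresentations1977, §2.3 Thm. 3] -/
theorem classInner_coe_hom {D : Type} [Group D] [Fintype D] (lam mu : D →* ℂˣ)
    [Decidable (lam = mu)] :
    classInner (fun d : D => ((lam d : ℂˣ) : ℂ)) (fun d : D => ((mu d : ℂˣ) : ℂ)) =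
      if lam = mu then 1 else 0 := by
  rw [classInner_apply]
  have hD : (Fintype.card D : ℂ) ≠ 0 := Nat.cast_ne_zero.mpr Fintype.card_ne_zero
  by_cases h : lam = mu
  · subst h
    rw [if_pos rfl, Finset.sum_congr rfl fun d _ => show
        ((lam d : ℂˣ) : ℂ) * ((lam d⁻¹ : ℂˣ) : ℂ) = 1 by
          rw [← Units.val_mul, ← map_mul, mul_inv_cancel, map_one, Units.val_one],
      Finset.sum_const, Finset.card_univ, nsmul_eq_mul, mul_one, inv_mul_cancel₀ hD]
  · -- `ν = lam · mu⁻¹ : D →* ℂ` is a non-trivial homomorphism, so `∑ ν = 0`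
    set f : D →* ℂ := (Units.coeHom ℂ).comp (lam * mu⁻¹) with hf
    have hterm : ∀ d : D, ((lam d : ℂˣ) : ℂ) * ((mu d⁻¹ : ℂˣ) : ℂ) = f d := fun d => by
      simp only [hf, MonoidHom.coe_comp, Function.comp_apply, MonoidHom.mul_apply,
        MonoidHom.inv_apply, Units.coeHom_apply, Units.val_mul, map_inv]
    have hf1 : f ≠ 1 := fun h1 => h (by
      ext d
      have := DFunLike.congr_fun h1 d
      simp only [hf, MonoidHom.coe_comp, Function.comp_apply, MonoidHom.mul_apply,
        MonoidHom.inv_apply, Units.coeHom_apply, MonoidHom.one_apply, Units.val_eq_one,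
        mul_inv_eq_one] at this
      rw [this])
    rw [if_neg h, Finset.sum_congr rfl fun d _ => hterm d, sum_hom_units_eq_zero f hf1, mul_zero]

open scoped Classical in
/-- **The Brauer pairing count** (BLGGT 2014, proof of Thm. 5.5.1, the number `(B, B) = 1`):
if `∑ᵢ nᵢ Ind_{Hᵢ}^G θᵢ = 1`, then
`∑_{i,j} nᵢ nⱼ #{q ∈ Hᵢ\G/Hⱼ : θᵢ ∘ (x ↦ g_q x g_q⁻¹) = θⱼ on Hⱼ ∩ g_q⁻¹ Hᵢ g_q} = 1`,
with `g_q = q.out` and the intersection realised as `mackeySubgroup (Hᵢ) (Hⱼ) g_q`.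
[cite: BarnetlambEtAl2014, proof of Thm. 5.5.1] [cite: SerreLinearRepresentations1977, §7.3–§7.4] -/
theorem sum_sum_card_doubleCoset_agree_eq_one {ι : Type} [Fintype ι] (H : ι → Subgroup G)
    (θ : ∀ i, H i →* ℂˣ) (n : ι → ℤ)
    (hB : ∀ s : G, ∑ i, (n i : ℂ) * indClassFun (H i) (fun h => ((θ i h : ℂˣ) : ℂ)) s = 1) :
    (∑ i, ∑ j, n i * n j * ∑ q : DoubleCoset.Quotient (H i : Set G) (H j : Set G),
      (if (θ i).comp (mackeyConjHom (H i) (H j) q.out) =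
          (θ j).comp (mackeySubgroup (H i) (H j) q.out).subtype then (1 : ℤ) else 0)) = 1 := by
  classical
  haveI : ∀ i, Fintype (H i) := fun i => Fintype.ofFinite _
  -- the functions `θ̂ᵢ = Ind θᵢ` and `B = ∑ nᵢ θ̂ᵢ = 1`
  set F : ι → G → ℂ := fun i => indClassFun (H i) (fun h => ((θ i h : ℂˣ) : ℂ)) with hF
  set B : G → ℂ := ∑ i, (n i : ℂ) • F i with hBdef
  have hB1 : B = 1 := by
    funext s
    simp only [hBdef, Finset.sum_apply, Pi.smul_apply, smul_eq_mul, Pi.one_apply]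
    exact hB s
  have h11 : classInner B B = 1 := by
    rw [hB1, classInner_apply]
    simp only [Pi.one_apply, mul_one, Finset.sum_const, Finset.card_univ, nsmul_eq_mul]
    exact inv_mul_cancel₀ (Nat.cast_ne_zero.mpr Fintype.card_ne_zero)
  -- bilinear expansion
  have hexp : classInner B B = ∑ i, (n i : ℂ) * ∑ j, (n j : ℂ) * classInner (F i) (F j) := by
    rw [hBdef, classInner_finset_sum_left]
    refine Finset.sum_congr rfl fun i _ => ?_
    rw [classInner_smul_left, classInner_comm, classInner_finset_sum_left]
    congr 1
    refine Finset.sum_congr rfl fun j _ => ?_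
    rw [classInner_smul_left, classInner_comm]
  -- each pairing `⟨Ind θᵢ, Ind θⱼ⟩` by reciprocity + Mackey + reciprocity + orthonormality
  have hpair : ∀ i j, classInner (F i) (F j) =
      ∑ q : DoubleCoset.Quotient (H i : Set G) (H j : Set G),
        (if (θ i).comp (mackeyConjHom (H i) (H j) q.out) =
            (θ j).comp (mackeySubgroup (H i) (H j) q.out).subtype then (1 : ℂ) else 0) := by
    intro i j
    haveI : ∀ q : DoubleCoset.Quotient (H i : Set G) (H j : Set G),
        Fintype (mackeySubgroup (H i) (H j) q.out) := fun q => Fintype.ofFinite _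
    rw [hF, classInner_indClassFun_right (H j) _ (isClassFun_indClassFun (H i) _)]
    have hM : (fun x : H j => indClassFun (H i) (fun h => ((θ i h : ℂˣ) : ℂ)) (x : G)) =
        ∑ q : DoubleCoset.Quotient (H i : Set G) (H j : Set G),
          indClassFun (mackeySubgroup (H i) (H j) q.out)
            ((fun h : H i => ((θ i h : ℂˣ) : ℂ)) ∘ mackeyConjHom (H i) (H j) q.out) := by
      funext x
      rw [Finset.sum_apply]
      exact indClassFun_restrict_eq_sum_doubleCoset (H i) (H j) (isClassFun_coe_hom (θ i)) x
    rw [hM, classInner_finset_sum_left]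
    refine Finset.sum_congr rfl fun q _ => ?_
    rw [classInner_indClassFun_left (mackeySubgroup (H i) (H j) q.out) _
      (isClassFun_coe_hom (θ j))]
    exact classInner_coe_hom ((θ i).comp (mackeyConjHom (H i) (H j) q.out))
      ((θ j).comp (mackeySubgroup (H i) (H j) q.out).subtype)
  have hC : (∑ i, (n i : ℂ) * ∑ j, (n j : ℂ) *
      ∑ q : DoubleCoset.Quotient (H i : Set G) (H j : Set G),
        (if (θ i).comp (mackeyConjHom (H i) (H j) q.out) =
            (θ j).comp (mackeySubgroup (H i) (H j) q.out).subtype then (1 : ℂ) else 0)) = 1 := by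
    have h' : (∑ i, (n i : ℂ) * ∑ j, (n j : ℂ) *
        ∑ q : DoubleCoset.Quotient (H i : Set G) (H j : Set G),
          (if (θ i).comp (mackeyConjHom (H i) (H j) q.out) =
              (θ j).comp (mackeySubgroup (H i) (H j) q.out).subtype then (1 : ℂ) else 0)) =
        classInner B B := by
      rw [hexp]
      simp_rw [hpair]
    exact h'.trans h11
  have hZ : ((∑ i, ∑ j, n i * n j * ∑ q : DoubleCoset.Quotient (H i : Set G) (H j : Set G),
      (if (θ i).comp (mackeyConjHom (H i) (H j) q.out) =
          (θ j).comp (mackeySubgroup (H i) (H j) q.out).subtype then (1 : ℤ) else 0) : ℤ) : ℂ)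
      = ∑ i, (n i : ℂ) * ∑ j, (n j : ℂ) *
      ∑ q : DoubleCoset.Quotient (H i : Set G) (H j : Set G),
        (if (θ i).comp (mackeyConjHom (H i) (H j) q.out) =
            (θ j).comp (mackeySubgroup (H i) (H j) q.out).subtype then (1 : ℂ) else 0) := by
    push_cast
    refine Finset.sum_congr rfl fun i _ => ?_
    rw [Finset.mul_sum]
    refine Finset.sum_congr rfl fun j _ => ?_
    ring
  exact_mod_cast hZ.trans hC

/-- `Ind_H^G θ (1) = [G : H]` for a degree-one character `θ`. [cite: SerreLinearRepresentations1977, §7.2] -/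
theorem indClassFun_coe_hom_one (H : Subgroup G) (θ : H →* ℂˣ) :
    indClassFun H (fun h => ((θ h : ℂˣ) : ℂ)) 1 = H.index := by
  classical
  rw [indClassFun_one]
  have h1 : ((θ ⟨1, H.one_mem⟩ : ℂˣ) : ℂ) = 1 := by
    rw [show (⟨1, H.one_mem⟩ : H) = 1 from rfl, map_one, Units.val_one]
  rw [h1, mul_one, ← Nat.card_eq_fintype_card, ← Subgroup.card_mul_index H, Nat.cast_mul,
    ← mul_assoc, inv_mul_cancel₀ (Nat.cast_ne_zero.mpr (Nat.card_pos (α := H)).ne'), one_mul]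

/-- From `∑ᵢ nᵢ Ind θᵢ = 1`: the degrees give `∑ᵢ nᵢ [G : Hᵢ] = 1`. [cite: BarnetlambEtAl2014, proof of Thm. 5.5.1] -/
theorem sum_mul_index_eq_one {ι : Type} [Fintype ι] (H : ι → Subgroup G)
    (θ : ∀ i, H i →* ℂˣ) (n : ι → ℤ)
    (hB : ∀ s : G, ∑ i, (n i : ℂ) * indClassFun (H i) (fun h => ((θ i h : ℂˣ) : ℂ)) s = 1) :
    ∑ i, n i * ((H i).index : ℤ) = 1 := by
  have h := hB 1
  simp_rw [indClassFun_coe_hom_one] at h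
  exact_mod_cast h

end PairingOverC

/-! ## The same count over an algebraically closed field `k`: `(B, B)` for `coind k(θᵢ)` -/

section PairingOverK

variable {k : Type} [Field k] [IsAlgClosed k] {Q : Type} [Group Q] [Fintype Q]

open scoped Classical in
/-- **Mackey count for induced degree-one characters**: for `S, T ≤ Q` (`Q` finite) and
`α : S →* kˣ`, `β : T →* kˣ`,
`dim_k Hom_Q(coind_S k(α), coind_T k(β)) = #{q ∈ S\Q/T : α ∘ (x ↦ g_q x g_q⁻¹) = β on T ∩ g_q⁻¹ S g_q}`
(`finrank_intertwiningMap_coind_coind` + the local term `finrank_intertwiningMap_twist_twist_of_equiv`).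
[cite: BarnetlambEtAl2014, § 5.5 preamble] -/
theorem finrank_intertwiningMap_coind_ofChar (S T : Subgroup Q) (α : S →* kˣ) (β : T →* kˣ) :
    Module.finrank k (Representation.IntertwiningMap
        (Representation.coind S.subtype (Representation.ofChar α))
        (Representation.coind T.subtype (Representation.ofChar β))) =
      ∑ q : DoubleCoset.Quotient (S : Set Q) (T : Set Q),
        (if α.comp (mackeyConjHom S T q.out) = β.comp (mackeySubgroup S T q.out).subtype
          then 1 else 0) := by
  classical
  rw [finrank_intertwiningMap_coind_coind]
  refine Finset.sum_congr rfl fun q _ => ?_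
  have hirr : Representation.IsIrreducible
      (((Representation.trivial k T k).comp (mackeySubgroup S T q.out).subtype).comp
        (1 : mackeySubgroup S T q.out →* mackeySubgroup S T q.out)) := by
    haveI : IsSimpleModule k k := isSimpleModule_iff_finrank_eq_one.2 (Module.finrank_self k)
    exact Representation.isIrreducible_of_isSimpleModule _
  have h := finrank_intertwiningMap_twist_twist_of_equiv
    (1 : mackeySubgroup S T q.out →* mackeySubgroup S T q.out)
    (Representation.Equiv.refl
      ((Representation.trivial k T k).comp (mackeySubgroup S T q.out).subtype))
    hirr (α.comp (mackeyConjHom S T q.out)) (β.comp (mackeySubgroup S T q.out).subtype)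
    (fun m => by rw [MonoidHom.one_apply, map_one]) (fun m => by rw [MonoidHom.one_apply, map_one])
  rw [show mackeyConjRep S T (Representation.ofChar α) q.out =
      Representation.twist ((Representation.trivial k T k).comp (mackeySubgroup S T q.out).subtype)
        (α.comp (mackeyConjHom S T q.out)) from MonoidHom.ext fun _ => rfl,
    show ((Representation.ofChar β).comp (mackeySubgroup S T q.out).subtype :
        Representation k (mackeySubgroup S T q.out) k) =
      Representation.twist ((Representation.trivial k T k).comp (mackeySubgroup S T q.out).subtype)
        (β.comp (mackeySubgroup S T q.out).subtype) from Representation.twist_comp _ _ _, h]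
  by_cases hc : α.comp (mackeyConjHom S T q.out) = β.comp (mackeySubgroup S T q.out).subtype
  · rw [if_pos hc, if_pos (by
      rw [hc]; ext1 x
      rw [MonoidHom.mul_apply, MonoidHom.inv_apply, MonoidHom.one_apply, mul_inv_cancel])]
  · rw [if_neg hc, if_neg fun h' => hc (by
      ext1 x
      have := DFunLike.congr_fun h' x
      rw [MonoidHom.mul_apply, MonoidHom.inv_apply, MonoidHom.one_apply, mul_inv_eq_one] at this
      exact this.symm)]

/-- **`(B, B) = 1` over `k`**: transporting Brauer data `1 = ∑ nᵢ Ind θᵢ` (over `ℂ`) along a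
ring homomorphism `e : ℂ →+* k` into an algebraically closed field `k`, the characters
`θ̃ᵢ = e ∘ θᵢ` satisfy `∑_{i,j} nᵢ nⱼ dim_k Hom_Q(coind k(θ̃ᵢ), coind k(θ̃ⱼ)) = 1`.
[cite: BarnetlambEtAl2014, proof of Thm. 5.5.1] -/
theorem sum_sum_finrank_intertwiningMap_coind_ofChar_eq_one (e : ℂ →+* k) {ι : Type} [Fintype ι]
    (H : ι → Subgroup Q) (θ : ∀ i, H i →* ℂˣ) (n : ι → ℤ)
    (hB : ∀ s : Q, ∑ i, (n i : ℂ) * indClassFun (H i) (fun h => ((θ i h : ℂˣ) : ℂ)) s = 1) :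
    (∑ i, ∑ j, n i * n j * (Module.finrank k (Representation.IntertwiningMap
        (Representation.coind (H i).subtype
          (Representation.ofChar ((Units.map (e : ℂ →* k)).comp (θ i))))
        (Representation.coind (H j).subtype
          (Representation.ofChar ((Units.map (e : ℂ →* k)).comp (θ j))))) : ℤ)) = 1 := by
  classical
  rw [← sum_sum_card_doubleCoset_agree_eq_one H θ n hB]
  refine Finset.sum_congr rfl fun i _ => Finset.sum_congr rfl fun j _ => ?_
  rw [finrank_intertwiningMap_coind_ofChar]
  push_cast
  congr 1
  refine Finset.sum_congr rfl fun q _ => ?_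
  have hinj : Function.Injective (Units.map (e : ℂ →* k)) := Units.map_injective e.injective
  by_cases hc : (θ i).comp (mackeyConjHom (H i) (H j) q.out) =
      (θ j).comp (mackeySubgroup (H i) (H j) q.out).subtype
  · have hc' : ((Units.map (e : ℂ →* k)).comp (θ i)).comp (mackeyConjHom (H i) (H j) q.out) =
        ((Units.map (e : ℂ →* k)).comp (θ j)).comp (mackeySubgroup (H i) (H j) q.out).subtype := by
      rw [MonoidHom.comp_assoc, hc, ← MonoidHom.comp_assoc]
    rw [if_pos hc, if_pos hc']
  · have hc' : ¬ ((Units.map (e : ℂ →* k)).comp (θ i)).comp (mackeyConjHom (H i) (H j) q.out) =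
        ((Units.map (e : ℂ →* k)).comp (θ j)).comp (mackeySubgroup (H i) (H j) q.out).subtype := by
      intro h'
      apply hc
      ext1 x
      exact hinj (DFunLike.congr_fun h' x)
    rw [if_neg hc, if_neg hc']

end PairingOverK

end Summit.Langlands.Langlands.Theorems.BrauerTaylorDescent

end
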